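import Literature.NumberTheory.LFunctions.FordZetaBoundKappa12
import Mathlib.MeasureTheory.Integral.Gamma
import HarnessLib

/-!
# The `κ`-lemma with `C = 13` (further banked slack for the explicit exponential-sum constant)

Topic `Literature/NumberTheory/LFunctions`.  Everything in this file is PROVED; no definition and
no named fact is introduced.

`FordZetaBoundKappa.lean` / `FordZetaBoundKappa12.lean` certify, for the deduction
"Ford's Theorem 2 ⟹ Theorem 1" (`FordZetaBoundMain*.lean`), that
`κ(y) = e^{−2y³}∫_0^{u*} e^{3y²u} du + C ∫_{u*}^{∞} e^{−(u−y)²(u+2y)} du ≤ 10` with `C = 9.463`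
(Ford's constant) resp. `C = 12`.  Here the bound `κ(y) ≤ 10.1` is certified with `C = 13`
(`u* = 34/25`).  The true supremum is `≈ 9.54` (near `y = 1.82`), so the closed-form Gaussian
majorants of the previous files (which ignore the cubic term of the phase) are no longer enough;
the new ingredient is the cubic correction for the piece `u ≥ y`:
`(u−y)²(u+2y) ≥ 3y₀(u−y)² + (u−y)³` and `e^{−v³} ≤ 1 − v³ + v⁶/2`, whence
`∫_y^∞ e^{−(u−y)²(u+2y)} du ≤ √(π/m)/2 − 1/(2m²) + 15√π/(32 m³√m)`, `m = 3y₀`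
(`FordVK.integral_cubic_gauss_le`, from the Gaussian moments `∫_0^∞ v³e^{−mv²} = 1/(2m²)`,
`∫_0^∞ v⁶e^{−mv²} = 15√π/(16 m³√m)` = Mathlib's `integral_rpow_mul_exp_neg_mul_rpow`).  The rest is
a finer cell decomposition (cells of width down to `1/40` near the peak), generated mechanically.

Purpose: an assembly of `zeta_bound_ford` from an exponential-sum bound
`S(N,t) ≤ 13 · N^{1−1/(133.66λ²)}`; the final constant of Theorem 1 is unchanged
(`(2 + e^{(34/25)³} + 2·13)/300^{2/3} + 10.1 · 5.113 · 1.443 < 75.5 ≤ 76.2`).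

## References

* K. Ford, *Vinogradov's integral and bounds for the Riemann zeta function*, Proc. London Math.
  Soc. (3) 85 (2002), 565–633; arXiv:1910.08209. Lemma 7.3 and the proof of Theorem 1 (§7).
  [Ford2002]
-/

noncomputable section

open Real MeasureTheory Set intervalIntegral

namespace Literature.NumberTheory.LFunctions

namespace FordVK

/-! ## Gaussian moments and the cubic correction -/

/-- `∫_0^∞ v³ e^{−mv²} dv = 1/(2m²)`. [folklore] -/
theorem integral_cube_mul_exp_neg_mul_sq {m : ℝ} (hm : 0 < m) :
    ∫ v in Ioi (0 : ℝ), v ^ 3 * Real.exp (-m * v ^ 2) = 1 / (2 * m ^ 2) := by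
  have h := integral_rpow_mul_exp_neg_mul_rpow (p := 2) (q := 3) (b := m) (by norm_num)
    (by norm_num) hm
  have e1 : (fun x : ℝ ↦ x ^ (3 : ℝ) * Real.exp (-m * x ^ (2 : ℝ)))
      = fun x : ℝ ↦ x ^ 3 * Real.exp (-m * x ^ 2) := by
    funext x
    rw [show (3 : ℝ) = (3 : ℕ) by norm_num, show (2 : ℝ) = (2 : ℕ) by norm_num, rpow_natCast,
      rpow_natCast]
  rw [e1] at h
  rw [h, show (-((3 : ℝ) + 1) / 2) = -2 by norm_num, show ((3 : ℝ) + 1) / 2 = (1 : ℕ) + 1 by norm_num,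
    Real.Gamma_nat_eq_factorial, Real.rpow_neg hm.le, show (2 : ℝ) = (2 : ℕ) by norm_num,
    rpow_natCast]
  simp

/-- `∫_0^∞ v⁶ e^{−mv²} dv = 15√π/(16 m³ √m)` (`Γ(7/2) = 15√π/8`). [folklore] -/
theorem integral_six_mul_exp_neg_mul_sq {m : ℝ} (hm : 0 < m) :
    ∫ v in Ioi (0 : ℝ), v ^ 6 * Real.exp (-m * v ^ 2) = 15 * Real.sqrt π / (16 * (m ^ 3 * Real.sqrt m)) := by
  have h := integral_rpow_mul_exp_neg_mul_rpow (p := 2) (q := 6) (b := m) (by norm_num)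
    (by norm_num) hm
  have e1 : (fun x : ℝ ↦ x ^ (6 : ℝ) * Real.exp (-m * x ^ (2 : ℝ)))
      = fun x : ℝ ↦ x ^ 6 * Real.exp (-m * x ^ 2) := by
    funext x
    rw [show (6 : ℝ) = (6 : ℕ) by norm_num, show (2 : ℝ) = (2 : ℕ) by norm_num, rpow_natCast,
      rpow_natCast]
  rw [e1] at h
  have hG : Real.Gamma (((6 : ℝ) + 1) / 2) = 15 * Real.sqrt π / 8 := by
    rw [show ((6 : ℝ) + 1) / 2 = (3 : ℕ) + 1 / 2 by norm_num, Real.Gamma_nat_add_half]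
    norm_num [Nat.doubleFactorial]
  have hpow : m ^ (-((6 : ℝ) + 1) / 2) = 1 / (m ^ 3 * Real.sqrt m) := by
    rw [show (-((6 : ℝ) + 1) / 2) = -(3 + 1 / 2) by norm_num, Real.rpow_neg hm.le,
      Real.rpow_add hm, show (3 : ℝ) = (3 : ℕ) by norm_num, rpow_natCast, Real.sqrt_eq_rpow]
    simp
  rw [h, hG, hpow]
  ring

/-- **Gaussian with a cubic correction.** For `m > 0` and `0 ≤ d ≤ e`:
`∫_d^e e^{−mv² − v³} dv ≤ √(π/m)/2 − 1/(2m²) + 15√π/(32 m³ √m)`, from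
`e^{−v³} ≤ 1 − v³ + v⁶/2` (`v ≥ 0`) and the Gaussian moments. [folklore] -/
theorem integral_cubic_gauss_le {m d e : ℝ} (hm : 0 < m) (hd : 0 ≤ d) (hde : d ≤ e) :
    ∫ v in d..e, Real.exp (-m * v ^ 2 - v ^ 3)
      ≤ Real.sqrt (π / m) / 2 - 1 / (2 * m ^ 2) + 15 * Real.sqrt π / (32 * (m ^ 3 * Real.sqrt m)) := by
  set g : ℝ → ℝ := fun v ↦ Real.exp (-m * v ^ 2) * (1 - v ^ 3 + (v ^ 3) ^ 2 / 2) with hg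
  -- pointwise on `v ≥ 0`
  have hpt : ∀ v, 0 ≤ v → Real.exp (-m * v ^ 2 - v ^ 3) ≤ g v := by
    intro v hv
    rw [hg, sub_eq_add_neg, Real.exp_add]
    exact mul_le_mul_of_nonneg_left (exp_neg_le_taylor2 (pow_nonneg hv 3)) (Real.exp_pos _).le
  have hgnn : ∀ v, 0 ≤ g v := by
    intro v
    rw [hg]
    refine mul_nonneg (Real.exp_pos _).le ?_
    nlinarith [sq_nonneg (v ^ 3 - 1)]
  -- integrability of the three pieces on `Ioi 0`
  have hi0 : IntegrableOn (fun v ↦ Real.exp (-m * v ^ 2)) (Ioi 0) :=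
    (integrable_exp_neg_mul_sq hm).integrableOn
  have hi3 : IntegrableOn (fun v : ℝ ↦ v ^ 3 * Real.exp (-m * v ^ 2)) (Ioi 0) := by
    have := (integrable_rpow_mul_exp_neg_mul_sq hm (s := 3) (by norm_num)).integrableOn (s := Ioi 0)
    refine this.congr_fun (fun v _ ↦ ?_) measurableSet_Ioi
    simp only
    rw [show (3 : ℝ) = (3 : ℕ) by norm_num, rpow_natCast]
  have hi6 : IntegrableOn (fun v : ℝ ↦ v ^ 6 * Real.exp (-m * v ^ 2)) (Ioi 0) := by
    have := (integrable_rpow_mul_exp_neg_mul_sq hm (s := 6) (by norm_num)).integrableOn (s := Ioi 0)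
    refine this.congr_fun (fun v _ ↦ ?_) measurableSet_Ioi
    simp only
    rw [show (6 : ℝ) = (6 : ℕ) by norm_num, rpow_natCast]
  have hgeq : g = fun v ↦ Real.exp (-m * v ^ 2) - v ^ 3 * Real.exp (-m * v ^ 2)
      + (1 / 2) * (v ^ 6 * Real.exp (-m * v ^ 2)) := by
    funext v; rw [hg]; ring
  have hgi : IntegrableOn g (Ioi 0) := by
    rw [hgeq]
    exact (hi0.sub hi3).add (hi6.const_mul _)
  -- the value of `∫_{Ioi 0} g`
  have hval : ∫ v in Ioi (0 : ℝ), g v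
      = Real.sqrt (π / m) / 2 - 1 / (2 * m ^ 2) + 15 * Real.sqrt π / (32 * (m ^ 3 * Real.sqrt m)) := by
    simp only [hgeq]
    rw [MeasureTheory.integral_add ?_ ?_, MeasureTheory.integral_sub hi0 hi3,
      MeasureTheory.integral_const_mul, integral_gaussian_Ioi m, integral_cube_mul_exp_neg_mul_sq hm,
      integral_six_mul_exp_neg_mul_sq hm]
    · ring
    · exact hi0.sub hi3
    · exact hi6.const_mul _
  -- compare
  have hfc : Continuous fun v : ℝ ↦ Real.exp (-m * v ^ 2 - v ^ 3) := by fun_prop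
  calc ∫ v in d..e, Real.exp (-m * v ^ 2 - v ^ 3)
      ≤ ∫ v in d..e, g v := by
        have hgc : Continuous g := by rw [hg]; fun_prop
        exact integral_mono_on hde (hfc.intervalIntegrable _ _) (hgc.intervalIntegrable _ _)
          fun v hv ↦ hpt v (hd.trans hv.1)
    _ ≤ ∫ v in Ioi (0 : ℝ), g v := by
        rw [integral_of_le hde]
        refine setIntegral_mono_set hgi (ae_of_all _ fun v ↦ hgnn v)
          (ae_of_all _ fun v hv ↦ lt_of_le_of_lt hd hv.1)
    _ = _ := hval

/-- Pointwise comparison for `y ≥ y₀`: `(u − y)²(u + 2y) ≥ 3y₀(u − y)² + (u − y)³`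
(indeed `u + 2y = 3y + (u − y)`; used for `u ≥ y`), in exponential form. [folklore] -/
theorem exp_neg_phi_le_cubic {y y₀ : ℝ} (hy : y₀ ≤ y) (u : ℝ) :
    Real.exp (-((u - y) ^ 2 * (u + 2 * y))) ≤ Real.exp (-(3 * y₀) * (u - y) ^ 2 - (u - y) ^ 3) := by
  apply Real.exp_le_exp.2
  nlinarith [mul_nonneg (sq_nonneg (u - y)) (by linarith : (0 : ℝ) ≤ y - y₀)]

/-- Second term on a cell `34/25 ≤ y₀ ≤ y ≤ y₁`, with the cubic correction for the piece `u ≥ y`: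
`∫_{34/25}^{V} e^{−(u−y)²(u+2y)} du ≤ LEFT + R`,
`R = √(π/m)/2 − 1/(2m²) + 15√π/(32 m³√m)`, `m = 3y₀`, and `LEFT` any of `y₁ − 34/25`,
`√(π/(34/25+2y₀))/2`, `d₁ − m₀d₁³/3 + m₀²d₁⁵/10` (`d₁ = y₁ − 34/25`, `m₀ = 34/25 + 2y₀`) as in
`FordVK.term2_le_of_ge_us` / `FordVK.term2_le_of_ge_taylor_us`. [folklore] -/
theorem term2_le_of_ge_cubic_us {y y₀ y₁ V : ℝ} (hy₀ : 34 / 25 ≤ y₀) (hy : y₀ ≤ y) (hy' : y ≤ y₁)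
    (hV : 34 / 25 ≤ V) :
    (∫ u in (34 / 25 : ℝ)..V, Real.exp (-((u - y) ^ 2 * (u + 2 * y)))
        ≤ (y₁ - 34 / 25) + (Real.sqrt (π / (3 * y₀)) / 2 - 1 / (2 * (3 * y₀) ^ 2)
            + 15 * Real.sqrt π / (32 * ((3 * y₀) ^ 3 * Real.sqrt (3 * y₀)))))
    ∧ (∫ u in (34 / 25 : ℝ)..V, Real.exp (-((u - y) ^ 2 * (u + 2 * y)))
        ≤ Real.sqrt (π / (34 / 25 + 2 * y₀)) / 2 + (Real.sqrt (π / (3 * y₀)) / 2 - 1 / (2 * (3 * y₀) ^ 2)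
            + 15 * Real.sqrt π / (32 * ((3 * y₀) ^ 3 * Real.sqrt (3 * y₀)))))
    ∧ (∫ u in (34 / 25 : ℝ)..V, Real.exp (-((u - y) ^ 2 * (u + 2 * y)))
        ≤ ((y₁ - 34 / 25) - (34 / 25 + 2 * y₀) * (y₁ - 34 / 25) ^ 3 / 3
            + (34 / 25 + 2 * y₀) ^ 2 * (y₁ - 34 / 25) ^ 5 / 10)
          + (Real.sqrt (π / (3 * y₀)) / 2 - 1 / (2 * (3 * y₀) ^ 2)
            + 15 * Real.sqrt π / (32 * ((3 * y₀) ^ 3 * Real.sqrt (3 * y₀))))) := by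
  have hy13 : 34 / 25 ≤ y := hy₀.trans hy
  have hy₀0 : 0 < y₀ := by linarith
  set f : ℝ → ℝ := fun u ↦ Real.exp (-((u - y) ^ 2 * (u + 2 * y))) with hf
  have hfc : Continuous f := by rw [hf]; fun_prop
  have hf0 : ∀ u, 0 ≤ f u := fun u ↦ (Real.exp_pos _).le
  set V' : ℝ := max V y with hV'
  have hmonoV : ∫ u in (34 / 25 : ℝ)..V, f u ≤ ∫ u in (34 / 25 : ℝ)..V', f u :=
    integral_mono_interval le_rfl hV (le_max_left _ _)
      (Filter.Eventually.of_forall fun u ↦ hf0 u) (hfc.intervalIntegrable _ _)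
  have hsplit : ∫ u in (34 / 25 : ℝ)..V', f u = (∫ u in (34 / 25 : ℝ)..y, f u) + ∫ u in y..V', f u :=
    (integral_add_adjacent_intervals (hfc.intervalIntegrable _ _) (hfc.intervalIntegrable _ _)).symm
  -- piece 2 with the cubic correction, `m = 3y₀`
  have hp2 : ∫ u in y..V', f u ≤ Real.sqrt (π / (3 * y₀)) / 2 - 1 / (2 * (3 * y₀) ^ 2)
      + 15 * Real.sqrt π / (32 * ((3 * y₀) ^ 3 * Real.sqrt (3 * y₀))) := by
    have hyV' : y ≤ V' := le_max_right _ _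
    have h1 : ∫ u in y..V', f u ≤ ∫ u in y..V', Real.exp (-(3 * y₀) * (u - y) ^ 2 - (u - y) ^ 3) := by
      refine integral_mono_on hyV' (hfc.intervalIntegrable _ _)
        ((by fun_prop : Continuous fun u ↦
          Real.exp (-(3 * y₀) * (u - y) ^ 2 - (u - y) ^ 3)).intervalIntegrable _ _) ?_
      intro u _
      exact exp_neg_phi_le_cubic hy u
    have e1 : ∫ u in y..V', Real.exp (-(3 * y₀) * (u - y) ^ 2 - (u - y) ^ 3)
        = ∫ v in (y - y : ℝ)..V' - y, Real.exp (-(3 * y₀) * v ^ 2 - v ^ 3) :=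
      intervalIntegral.integral_comp_sub_right (fun v ↦ Real.exp (-(3 * y₀) * v ^ 2 - v ^ 3)) y
    have e3 := integral_cubic_gauss_le (m := 3 * y₀) (by positivity) (d := y - y) (e := V' - y)
      (by simp) (by linarith)
    linarith
  -- piece 1: the three majorants of the previous files, redone for the piece `34/25 ≤ u ≤ y`
  set m : ℝ := 34 / 25 + 2 * y with hm
  have hm0 : 0 < m := by rw [hm]; linarith
  have hp1 : ∫ u in (34 / 25 : ℝ)..y, f u ≤ ∫ u in (34 / 25 : ℝ)..y, Real.exp (-m * (u - y) ^ 2) := by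
    refine integral_mono_on hy13 (hfc.intervalIntegrable _ _)
      ((by fun_prop : Continuous fun u ↦ Real.exp (-m * (u - y) ^ 2)).intervalIntegrable _ _) ?_
    intro u hu
    exact exp_neg_phi_le_gauss_us hu.1
  -- (a) `≤ y₁ − 34/25`
  have hp1a : ∫ u in (34 / 25 : ℝ)..y, Real.exp (-m * (u - y) ^ 2) ≤ y₁ - 34 / 25 := by
    have : ∫ u in (34 / 25 : ℝ)..y, Real.exp (-m * (u - y) ^ 2) ≤ ∫ u in (34 / 25 : ℝ)..y, (1 : ℝ) := by
      refine integral_mono_on hy13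
        ((by fun_prop : Continuous fun u ↦ Real.exp (-m * (u - y) ^ 2)).intervalIntegrable _ _)
        (continuous_const.intervalIntegrable _ _) ?_
      intro u _
      rw [Real.exp_le_one_iff]
      nlinarith [sq_nonneg (u - y)]
    rw [intervalIntegral.integral_const, smul_eq_mul, mul_one] at this
    linarith
  -- (b) `≤ √(π/(34/25+2y₀))/2`
  have e1 : ∫ u in (34 / 25 : ℝ)..y, Real.exp (-m * (u - y) ^ 2)
      = ∫ w in (0 : ℝ)..y - 34 / 25, Real.exp (-m * w ^ 2) := by
    rw [intervalIntegral.integral_comp_sub_right (fun v ↦ Real.exp (-m * v ^ 2)) y, sub_self]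
    rw [show (∫ x in (34 / 25 - y : ℝ)..0, Real.exp (-m * x ^ 2))
        = ∫ x in (34 / 25 - y : ℝ)..0, Real.exp (-m * (-x) ^ 2) by simp only [even_two, Even.neg_pow]]
    rw [intervalIntegral.integral_comp_neg (fun w ↦ Real.exp (-m * w ^ 2)), neg_zero, neg_sub]
  have hp1b : ∫ u in (34 / 25 : ℝ)..y, Real.exp (-m * (u - y) ^ 2)
      ≤ Real.sqrt (π / (34 / 25 + 2 * y₀)) / 2 := by
    rw [e1]
    have e3 := integral_gaussian_piece_le hm0 (d := 0) (e := y - 34 / 25) le_rfl (by linarith)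
    have h4 : Real.sqrt (π / m) ≤ Real.sqrt (π / (34 / 25 + 2 * y₀)) := by
      apply Real.sqrt_le_sqrt
      exact div_le_div_of_nonneg_left Real.pi_pos.le (by linarith) (by rw [hm]; linarith)
    linarith
  -- (c) Taylor form
  set m₀ : ℝ := 34 / 25 + 2 * y₀ with hm₀
  set d₁ : ℝ := y₁ - 34 / 25 with hd₁
  have hm₀0 : 0 < m₀ := by rw [hm₀]; linarith
  have hp1c : ∫ u in (34 / 25 : ℝ)..y, Real.exp (-m * (u - y) ^ 2)
      ≤ d₁ - m₀ * d₁ ^ 3 / 3 + m₀ ^ 2 * d₁ ^ 5 / 10 := by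
    rw [e1]
    have e2 : ∫ w in (0 : ℝ)..y - 34 / 25, Real.exp (-m * w ^ 2)
        ≤ ∫ w in (0 : ℝ)..d₁, Real.exp (-m₀ * w ^ 2) := by
      calc ∫ w in (0 : ℝ)..y - 34 / 25, Real.exp (-m * w ^ 2)
          ≤ ∫ w in (0 : ℝ)..d₁, Real.exp (-m * w ^ 2) :=
            integral_mono_interval le_rfl (by linarith) (by rw [hd₁]; linarith)
              (Filter.Eventually.of_forall fun w ↦ (Real.exp_pos _).le)
              ((by fun_prop : Continuous fun w ↦ Real.exp (-m * w ^ 2)).intervalIntegrable _ _)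
        _ ≤ ∫ w in (0 : ℝ)..d₁, Real.exp (-m₀ * w ^ 2) := by
            refine integral_mono_on (by rw [hd₁]; linarith)
              ((by fun_prop : Continuous fun w ↦ Real.exp (-m * w ^ 2)).intervalIntegrable _ _)
              ((by fun_prop : Continuous fun w ↦ Real.exp (-m₀ * w ^ 2)).intervalIntegrable _ _) ?_
            intro w _
            apply Real.exp_le_exp.2
            have : m₀ ≤ m := by rw [hm₀, hm]; linarith
            nlinarith [sq_nonneg w]
    have e3 := integral_gaussian_trunc_le hm₀0.le (d := d₁) (by rw [hd₁]; linarith)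
    linarith
  have htot : ∫ u in (34 / 25 : ℝ)..V, f u ≤ (∫ u in (34 / 25 : ℝ)..y, Real.exp (-m * (u - y) ^ 2))
      + (Real.sqrt (π / (3 * y₀)) / 2 - 1 / (2 * (3 * y₀) ^ 2)
        + 15 * Real.sqrt π / (32 * ((3 * y₀) ^ 3 * Real.sqrt (3 * y₀)))) := by linarith
  refine ⟨by linarith, by linarith, ?_⟩
  have : (y₁ - 34 / 25) - (34 / 25 + 2 * y₀) * (y₁ - 34 / 25) ^ 3 / 3
      + (34 / 25 + 2 * y₀) ^ 2 * (y₁ - 34 / 25) ^ 5 / 10 = d₁ - m₀ * d₁ ^ 3 / 3 + m₀ ^ 2 * d₁ ^ 5 / 10 := by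
    rw [hd₁, hm₀]
  rw [this]
  linarith

/-- `√π ≤ 1.7725` (`π < 3.141593 < 1.7725²`). [folklore] -/
theorem sqrt_pi_le : Real.sqrt π ≤ 1.7725 := by
  rw [Real.sqrt_le_left (by norm_num)]
  nlinarith [Real.pi_lt_d6]

/-- Numerical form of the cubic-corrected right piece: from `3.1416 ≤ 4g²m`, `0 < s`, `s² ≤ m`,
`√(π/m)/2 − 1/(2m²) + 15√π/(32 m³√m) ≤ g − 1/(2m²) + 26.5875/(32 m³ s)`. [folklore] -/
theorem rcubic_le {m g s : ℝ} (hm : 0 < m) (hg : 0 ≤ g) (h : 3.1416 ≤ 4 * g ^ 2 * m)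
    (hs : 0 < s) (hs2 : s ^ 2 ≤ m) :
    Real.sqrt (π / m) / 2 - 1 / (2 * m ^ 2) + 15 * Real.sqrt π / (32 * (m ^ 3 * Real.sqrt m))
      ≤ g - 1 / (2 * m ^ 2) + 26.5875 / (32 * (m ^ 3 * s)) := by
  have h1 := sqrt_pi_div_le hm hg h
  have hsm : s ≤ Real.sqrt m := Real.le_sqrt_of_sq_le hs2
  have h2 : 15 * Real.sqrt π / (32 * (m ^ 3 * Real.sqrt m)) ≤ 26.5875 / (32 * (m ^ 3 * s)) := by
    have hnum : 15 * Real.sqrt π ≤ 26.5875 := by nlinarith [sqrt_pi_le, Real.sqrt_nonneg π]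
    have hden : 32 * (m ^ 3 * s) ≤ 32 * (m ^ 3 * Real.sqrt m) := by
      have := pow_pos hm 3
      nlinarith
    calc 15 * Real.sqrt π / (32 * (m ^ 3 * Real.sqrt m))
        ≤ 26.5875 / (32 * (m ^ 3 * Real.sqrt m)) :=
          div_le_div_of_nonneg_right hnum (by positivity)
      _ ≤ 26.5875 / (32 * (m ^ 3 * s)) :=
          div_le_div_of_nonneg_left (by norm_num) (by positivity) hden
  linarith

/-! ## Numerical constants for the cells -/

/-- Numerical constant for the `κ₁₃` cell above `34/25` starting at `73 / 50`. [folklore] -/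
theorem k13_expA_73_50 : Real.exp (3 * (73 / 50) ^ 2 * (34 / 25) - 2 * (73 / 50) ^ 3) ≤ 11.857 := by
  have := VK.exp_le_of_expUB_le (k := 2) (f := 29541 / 62500) (X := 11.857) (by norm_num) (by norm_num)
    (by norm_num [VK.expUB])
  convert this using 2; norm_num

/-- Numerical constant for the `κ₁₃` cell above `34/25` starting at `39 / 25`. [folklore] -/
theorem k13_expA_39_25 : Real.exp (3 * (39 / 25) ^ 2 * (34 / 25) - 2 * (39 / 25) ^ 3) ≤ 10.346 := by
  have := VK.exp_le_of_expUB_le (k := 2) (f := 5254 / 15625) (X := 10.346) (by norm_num) (by norm_num)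
    (by norm_num [VK.expUB])
  convert this using 2; norm_num

/-- Numerical constant for the `κ₁₃` cell above `34/25` starting at `83 / 50`. [folklore] -/
theorem k13_expA_83_50 : Real.exp (3 * (83 / 50) ^ 2 * (34 / 25) - 2 * (83 / 50) ^ 3) ≤ 8.123 := by
  have := VK.exp_le_of_expUB_le (k := 2) (f := 5891 / 62500) (X := 8.123) (by norm_num) (by norm_num)
    (by norm_num [VK.expUB])
  convert this using 2; norm_num

/-- Numerical constant for the `κ₁₃` cell above `34/25` starting at `171 / 100`. [folklore] -/
theorem k13_expA_171_100 : Real.exp (3 * (171 / 100) ^ 2 * (34 / 25) - 2 * (171 / 100) ^ 3) ≤ 6.892 := by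
  have := VK.exp_le_of_expUB_le (k := 1) (f := 464953 / 500000) (X := 6.892) (by norm_num) (by norm_num)
    (by norm_num [VK.expUB])
  convert this using 2; norm_num

/-- Numerical constant for the `κ₁₃` cell above `34/25` starting at `44 / 25`. [folklore] -/
theorem k13_expA_44_25 : Real.exp (3 * (44 / 25) ^ 2 * (34 / 25) - 2 * (44 / 25) ^ 3) ≤ 5.670 := by
  have := VK.exp_le_of_expUB_le (k := 1) (f := 11479 / 15625) (X := 5.670) (by norm_num) (by norm_num)
    (by norm_num [VK.expUB])
  convert this using 2; norm_num

/-- Numerical constant for the `κ₁₃` cell above `34/25` starting at `181 / 100`. [folklore] -/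
theorem k13_expA_181_100 : Real.exp (3 * (181 / 100) ^ 2 * (34 / 25) - 2 * (181 / 100) ^ 3) ≤ 4.517 := by
  have := VK.exp_le_of_expUB_le (k := 1) (f := 253503 / 500000) (X := 4.517) (by norm_num) (by norm_num)
    (by norm_num [VK.expUB])
  convert this using 2; norm_num

/-- Numerical constant for the `κ₁₃` cell above `34/25` starting at `93 / 50`. [folklore] -/
theorem k13_expA_93_50 : Real.exp (3 * (93 / 50) ^ 2 * (34 / 25) - 2 * (93 / 50) ^ 3) ≤ 3.478 := by
  have := VK.exp_le_of_expUB_le (k := 1) (f := 15341 / 62500) (X := 3.478) (by norm_num) (by norm_num)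
    (by norm_num [VK.expUB])
  convert this using 2; norm_num

/-- Numerical constant for the `κ₁₃` cell above `34/25` starting at `377 / 200`. [folklore] -/
theorem k13_expA_377_200 : Real.exp (3 * (377 / 200) ^ 2 * (34 / 25) - 2 * (377 / 200) ^ 3) ≤ 3.012 := by
  have := VK.exp_le_of_expUB_le (k := 1) (f := 405999 / 4000000) (X := 3.012) (by norm_num) (by norm_num)
    (by norm_num [VK.expUB])
  convert this using 2; norm_num

/-! ## The `κ`-lemma with `C = 13`, cell by cell -/

/-- The `κ₁₃`-bound on the range `0 ≤ y ≤ 34/25`. [folklore] -/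
theorem kappa13_le_part0 {y V : ℝ} (hy : 0 ≤ y) (hhi : y ≤ 34 / 25) (hV : 34 / 25 ≤ V) :
    Real.exp (-2 * y ^ 3) * (∫ u in (0 : ℝ)..34 / 25, Real.exp (3 * y ^ 2 * u))
      + 13 * ∫ u in (34 / 25 : ℝ)..V, Real.exp (-((u - y) ^ 2 * (u + 2 * y))) ≤ 10.1 := by
  have hEus := exp_cube_us_le
  rcases le_or_gt y (3 / 5) with hc | hc
  · -- cell [0.0, 0.6]: P ≤ 3.1002, Q ≤ 0.2312, total 6.1058
    have hP := term1_le_of_le_us hy hc (by norm_num)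
    have hE := k12_expB_0
    have hP' : (Real.exp (3 * (3 / 5) ^ 2 * (34 / 25)) - 1) / (3 * (3 / 5) ^ 2) ≤ 3.1002 := by
      rw [div_le_iff₀ (by norm_num)]; linarith
    have hQ := term2_le_tail_of_le_us (by norm_num) hy hc (by norm_num) hV
    have hX : Real.exp (-(34 / 25 + 2 * (0)) * (34 / 25 - 3 / 5) ^ 2) ≤ 0.4777 := by
      have := exp_neg_le_of_quadratic (c := 12274 / 15625) (X := 0.4777) (by norm_num) (by norm_num) (by norm_num)
      convert this using 2; norm_num
    have hQ' : Real.exp (-(34 / 25 + 2 * (0)) * (34 / 25 - 3 / 5) ^ 2)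
        / (2 * (34 / 25 + 2 * (0)) * (34 / 25 - 3 / 5)) ≤ 0.2312 := by
      rw [div_le_iff₀ (by norm_num)]; linarith
    linarith
  have hprev := hc
  rcases le_or_gt y (4 / 5) with hc | hc
  · -- cell [0.6, 0.8]: P ≤ 6.5725, Q ≤ 0.1643, total 8.7084
    have hP := term1_le_of_le_us hy hc (by norm_num)
    have hE := k12_expB_1
    have hP' : (Real.exp (3 * (4 / 5) ^ 2 * (34 / 25)) - 1) / (3 * (4 / 5) ^ 2) ≤ 6.5725 := by
      rw [div_le_iff₀ (by norm_num)]; linarith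
    have hQ := term2_le_tail_of_le_us (by norm_num) hprev.le hc (by norm_num) hV
    have hX : Real.exp (-(34 / 25 + 2 * (3 / 5)) * (34 / 25 - 4 / 5) ^ 2) ≤ 0.4707 := by
      have := exp_neg_le_of_quadratic (c := 12544 / 15625) (X := 0.4707) (by norm_num) (by norm_num) (by norm_num)
      convert this using 2; norm_num
    have hQ' : Real.exp (-(34 / 25 + 2 * (3 / 5)) * (34 / 25 - 4 / 5) ^ 2)
        / (2 * (34 / 25 + 2 * (3 / 5)) * (34 / 25 - 4 / 5)) ≤ 0.1643 := by
      rw [div_le_iff₀ (by norm_num)]; linarith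
    linarith
  have hprev := hc
  rcases le_or_gt y (9 / 10) with hc | hc
  · -- cell [0.8, 0.9]: P ≤ 6.4481, Q ≤ 0.2017, total 9.0702
    have hP := term1_le_of_ge_us (by norm_num : (0 : ℝ) < 4 / 5) hprev.le
    have hP' : Real.exp ((34 / 25) ^ 3) / (3 * (4 / 5) ^ 2) ≤ 6.4481 := by
      rw [div_le_iff₀ (by norm_num)]; linarith [hEus]
    have hQ := term2_le_tail_of_le_us (by norm_num) hprev.le hc (by norm_num) hV
    have hX : Real.exp (-(34 / 25 + 2 * (4 / 5)) * (34 / 25 - 9 / 10) ^ 2) ≤ 0.5489 := by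
      have := exp_neg_le_of_quadratic (c := 19573 / 31250) (X := 0.5489) (by norm_num) (by norm_num) (by norm_num)
      convert this using 2; norm_num
    have hQ' : Real.exp (-(34 / 25 + 2 * (4 / 5)) * (34 / 25 - 9 / 10) ^ 2)
        / (2 * (34 / 25 + 2 * (4 / 5)) * (34 / 25 - 9 / 10)) ≤ 0.2017 := by
      rw [div_le_iff₀ (by norm_num)]; linarith
    linarith
  have hprev := hc
  rcases le_or_gt y (1) with hc | hc
  · -- cell [0.9, 1.0]: P ≤ 5.0948, Q ≤ 0.2945, total 8.9233
    have hP := term1_le_of_ge_us (by norm_num : (0 : ℝ) < 9 / 10) hprev.le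
    have hP' : Real.exp ((34 / 25) ^ 3) / (3 * (9 / 10) ^ 2) ≤ 5.0948 := by
      rw [div_le_iff₀ (by norm_num)]; linarith [hEus]
    have hQ := term2_le_tail_of_le_us (by norm_num) hprev.le hc (by norm_num) hV
    have hX : Real.exp (-(34 / 25 + 2 * (9 / 10)) * (34 / 25 - 1) ^ 2) ≤ 0.6698 := by
      have := exp_neg_le_of_quadratic (c := 6399 / 15625) (X := 0.6698) (by norm_num) (by norm_num) (by norm_num)
      convert this using 2; norm_num
    have hQ' : Real.exp (-(34 / 25 + 2 * (9 / 10)) * (34 / 25 - 1) ^ 2)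
        / (2 * (34 / 25 + 2 * (9 / 10)) * (34 / 25 - 1)) ≤ 0.2945 := by
      rw [div_le_iff₀ (by norm_num)]; linarith
    linarith
  have hprev := hc
  rcases le_or_gt y (21 / 20) with hc | hc
  · -- cell [1.0, 1.05]: P ≤ 4.1268, Q ≤ 0.3493, total 8.6677
    have hP := term1_le_of_ge_us (by norm_num : (0 : ℝ) < 1) hprev.le
    have hP' : Real.exp ((34 / 25) ^ 3) / (3 * (1) ^ 2) ≤ 4.1268 := by
      rw [div_le_iff₀ (by norm_num)]; linarith [hEus]
    have hQ := term2_le_tail_of_le_us (by norm_num) hprev.le hc (by norm_num) hV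
    have hX : Real.exp (-(34 / 25 + 2 * (1)) * (34 / 25 - 21 / 20) ^ 2) ≤ 0.7274 := by
      have := exp_neg_le_of_quadratic (c := 20181 / 62500) (X := 0.7274) (by norm_num) (by norm_num) (by norm_num)
      convert this using 2; norm_num
    have hQ' : Real.exp (-(34 / 25 + 2 * (1)) * (34 / 25 - 21 / 20) ^ 2)
        / (2 * (34 / 25 + 2 * (1)) * (34 / 25 - 21 / 20)) ≤ 0.3493 := by
      rw [div_le_iff₀ (by norm_num)]; linarith
    linarith
  have hprev := hc
  rcases le_or_gt y (11 / 10) with hc | hc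
  · -- cell [1.05, 1.1]: P ≤ 3.7432, Q ≤ 0.4409, total 9.4749
    have hP := term1_le_of_ge_us (by norm_num : (0 : ℝ) < 21 / 20) hprev.le
    have hP' : Real.exp ((34 / 25) ^ 3) / (3 * (21 / 20) ^ 2) ≤ 3.7432 := by
      rw [div_le_iff₀ (by norm_num)]; linarith [hEus]
    have hQ := term2_le_tail_of_le_us (by norm_num) hprev.le hc (by norm_num) hV
    have hX : Real.exp (-(34 / 25 + 2 * (21 / 20)) * (34 / 25 - 11 / 10) ^ 2) ≤ 0.7930 := by
      have := exp_neg_le_of_quadratic (c := 29237 / 125000) (X := 0.7930) (by norm_num) (by norm_num) (by norm_num)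
      convert this using 2; norm_num
    have hQ' : Real.exp (-(34 / 25 + 2 * (21 / 20)) * (34 / 25 - 11 / 10) ^ 2)
        / (2 * (34 / 25 + 2 * (21 / 20)) * (34 / 25 - 11 / 10)) ≤ 0.4409 := by
      rw [div_le_iff₀ (by norm_num)]; linarith
    linarith
  have hprev := hc
  rcases le_or_gt y (23 / 20) with hc | hc
  · -- cell [1.1, 1.15]: P ≤ 3.4106, Q ≤ 0.4698, total 9.5180
    have hP := term1_le_of_ge_us (by norm_num : (0 : ℝ) < 11 / 10) hprev.le
    have hP' : Real.exp ((34 / 25) ^ 3) / (3 * (11 / 10) ^ 2) ≤ 3.4106 := by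
      rw [div_le_iff₀ (by norm_num)]; linarith [hEus]
    have hQ := term2_le_gauss_of_le_us (by norm_num) hprev.le (hc.trans (by norm_num)) hV
    have hG : Real.sqrt (π / (34 / 25 + 2 * (11 / 10))) / 2 ≤ 0.4698 :=
      sqrt_pi_div_le (by norm_num) (by norm_num) (by norm_num)
    linarith
  have hprev := hc
  rcases le_or_gt y (6 / 5) with hc | hc
  · -- cell [1.15, 1.2]: P ≤ 3.1205, Q ≤ 0.4634, total 9.1447
    have hP := term1_le_of_ge_us (by norm_num : (0 : ℝ) < 23 / 20) hprev.le
    have hP' : Real.exp ((34 / 25) ^ 3) / (3 * (23 / 20) ^ 2) ≤ 3.1205 := by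
      rw [div_le_iff₀ (by norm_num)]; linarith [hEus]
    have hQ := term2_le_gauss_of_le_us (by norm_num) hprev.le (hc.trans (by norm_num)) hV
    have hG : Real.sqrt (π / (34 / 25 + 2 * (23 / 20))) / 2 ≤ 0.4634 :=
      sqrt_pi_div_le (by norm_num) (by norm_num) (by norm_num)
    linarith
  have hprev := hc
  rcases le_or_gt y (5 / 4) with hc | hc
  · -- cell [1.2, 1.25]: P ≤ 2.8659, Q ≤ 0.4572, total 8.8095
    have hP := term1_le_of_ge_us (by norm_num : (0 : ℝ) < 6 / 5) hprev.le
    have hP' : Real.exp ((34 / 25) ^ 3) / (3 * (6 / 5) ^ 2) ≤ 2.8659 := by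
      rw [div_le_iff₀ (by norm_num)]; linarith [hEus]
    have hQ := term2_le_gauss_of_le_us (by norm_num) hprev.le (hc.trans (by norm_num)) hV
    have hG : Real.sqrt (π / (34 / 25 + 2 * (6 / 5))) / 2 ≤ 0.4572 :=
      sqrt_pi_div_le (by norm_num) (by norm_num) (by norm_num)
    linarith
  have hprev := hc
  rcases le_or_gt y (13 / 10) with hc | hc
  · -- cell [1.25, 1.3]: P ≤ 2.6412, Q ≤ 0.4512, total 8.5068
    have hP := term1_le_of_ge_us (by norm_num : (0 : ℝ) < 5 / 4) hprev.le
    have hP' : Real.exp ((34 / 25) ^ 3) / (3 * (5 / 4) ^ 2) ≤ 2.6412 := by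
      rw [div_le_iff₀ (by norm_num)]; linarith [hEus]
    have hQ := term2_le_gauss_of_le_us (by norm_num) hprev.le (hc.trans (by norm_num)) hV
    have hG : Real.sqrt (π / (34 / 25 + 2 * (5 / 4))) / 2 ≤ 0.4512 :=
      sqrt_pi_div_le (by norm_num) (by norm_num) (by norm_num)
    linarith
  have hprev := hc
  have hc := hhi
  -- cell [1.3, 1.36]: P ≤ 2.4420, Q ≤ 0.4455, total 8.2335
  have hP := term1_le_of_ge_us (by norm_num : (0 : ℝ) < 13 / 10) hprev.le
  have hP' : Real.exp ((34 / 25) ^ 3) / (3 * (13 / 10) ^ 2) ≤ 2.4420 := by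
    rw [div_le_iff₀ (by norm_num)]; linarith [hEus]
  have hQ := term2_le_gauss_of_le_us (by norm_num) hprev.le (hc.trans (by norm_num)) hV
  have hG : Real.sqrt (π / (34 / 25 + 2 * (13 / 10))) / 2 ≤ 0.4455 :=
    sqrt_pi_div_le (by norm_num) (by norm_num) (by norm_num)
  linarith

/-- The `κ₁₃`-bound on the range no. 1 of `y ≥ 34/25`. [folklore] -/
theorem kappa13_le_part1 {y V : ℝ} (hlo : 34 / 25 ≤ y) (hhi : y ≤ 377 / 200) (hV : 34 / 25 ≤ V) :
    Real.exp (-2 * y ^ 3) * (∫ u in (0 : ℝ)..34 / 25, Real.exp (3 * y ^ 2 * u))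
      + 13 * ∫ u in (34 / 25 : ℝ)..V, Real.exp (-((u - y) ^ 2 * (u + 2 * y))) ≤ 10.1 := by
  rcases le_or_gt y (73 / 50) with hc | hc
  · -- cell [1.36, 1.46]: P ≤ 2.2305, left(T) ≤ 0.0988, R ≤ 0.4151, total 8.9112
    have hP := term1_le_of_gep_us (by norm_num) hlo
    have hE := k12_expA_0
    have hP' : Real.exp (3 * (34 / 25) ^ 2 * (34 / 25) - 2 * (34 / 25) ^ 3) / (3 * (34 / 25) ^ 2) ≤ 2.2305 := by
      rw [div_le_iff₀ (by norm_num)]; linarith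
    have hR := rcubic_le (m := 3 * (34 / 25)) (g := 0.4389) (s := 2.0199) (by norm_num) (by norm_num) (by norm_num) (by norm_num) (by norm_num)
    have hR' : (0.4389 : ℝ) - 1 / (2 * (3 * (34 / 25)) ^ 2) + 26.5875 / (32 * ((3 * (34 / 25)) ^ 3 * 2.0199)) ≤ 0.4151 := by
      norm_num
    have hQ := (term2_le_of_ge_cubic_us (by norm_num) hlo hc hV).2.2
    linarith
  have hprev := hc
  rcases le_or_gt y (39 / 25) with hc | hc
  · -- cell [1.46, 1.56]: P ≤ 1.8543, left(T) ≤ 0.1893, R ≤ 0.4024, total 9.5464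
    have hP := term1_le_of_gep_us (by norm_num) hprev.le
    have hE := k13_expA_73_50
    have hP' : Real.exp (3 * (73 / 50) ^ 2 * (34 / 25) - 2 * (73 / 50) ^ 3) / (3 * (73 / 50) ^ 2) ≤ 1.8543 := by
      rw [div_le_iff₀ (by norm_num)]; linarith
    have hR := rcubic_le (m := 3 * (73 / 50)) (g := 0.4236) (s := 2.0928) (by norm_num) (by norm_num) (by norm_num) (by norm_num) (by norm_num)
    have hR' : (0.4236 : ℝ) - 1 / (2 * (3 * (73 / 50)) ^ 2) + 26.5875 / (32 * ((3 * (73 / 50)) ^ 3 * 2.0928)) ≤ 0.4024 := by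
      norm_num
    have hQ := (term2_le_of_ge_cubic_us (by norm_num) hprev.le hc hV).2.2
    linarith
  have hprev := hc
  rcases le_or_gt y (83 / 50) with hc | hc
  · -- cell [1.56, 1.66]: P ≤ 1.4173, left(T) ≤ 0.2647, R ≤ 0.3909, total 9.9401
    have hP := term1_le_of_gep_us (by norm_num) hprev.le
    have hE := k13_expA_39_25
    have hP' : Real.exp (3 * (39 / 25) ^ 2 * (34 / 25) - 2 * (39 / 25) ^ 3) / (3 * (39 / 25) ^ 2) ≤ 1.4173 := by
      rw [div_le_iff₀ (by norm_num)]; linarith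
    have hR := rcubic_le (m := 3 * (39 / 25)) (g := 0.4098) (s := 2.1633) (by norm_num) (by norm_num) (by norm_num) (by norm_num) (by norm_num)
    have hR' : (0.4098 : ℝ) - 1 / (2 * (3 * (39 / 25)) ^ 2) + 26.5875 / (32 * ((3 * (39 / 25)) ^ 3 * 2.1633)) ≤ 0.3909 := by
      norm_num
    have hQ := (term2_le_of_ge_cubic_us (by norm_num) hprev.le hc hV).2.2
    linarith
  have hprev := hc
  rcases le_or_gt y (171 / 100) with hc | hc
  · -- cell [1.66, 1.71]: P ≤ 0.9828, left(T) ≤ 0.2948, R ≤ 0.3803, total 9.7591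
    have hP := term1_le_of_gep_us (by norm_num) hprev.le
    have hE := k13_expA_83_50
    have hP' : Real.exp (3 * (83 / 50) ^ 2 * (34 / 25) - 2 * (83 / 50) ^ 3) / (3 * (83 / 50) ^ 2) ≤ 0.9828 := by
      rw [div_le_iff₀ (by norm_num)]; linarith
    have hR := rcubic_le (m := 3 * (83 / 50)) (g := 0.3973) (s := 2.2315) (by norm_num) (by norm_num) (by norm_num) (by norm_num) (by norm_num)
    have hR' : (0.3973 : ℝ) - 1 / (2 * (3 * (83 / 50)) ^ 2) + 26.5875 / (32 * ((3 * (83 / 50)) ^ 3 * 2.2315)) ≤ 0.3803 := by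
      norm_num
    have hQ := (term2_le_of_ge_cubic_us (by norm_num) hprev.le hc hV).2.2
    linarith
  have hprev := hc
  rcases le_or_gt y (44 / 25) with hc | hc
  · -- cell [1.71, 1.76]: P ≤ 0.7858, left(T) ≤ 0.3216, R ≤ 0.3753, total 9.8455
    have hP := term1_le_of_gep_us (by norm_num) hprev.le
    have hE := k13_expA_171_100
    have hP' : Real.exp (3 * (171 / 100) ^ 2 * (34 / 25) - 2 * (171 / 100) ^ 3) / (3 * (171 / 100) ^ 2) ≤ 0.7858 := by
      rw [div_le_iff₀ (by norm_num)]; linarith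
    have hR := rcubic_le (m := 3 * (171 / 100)) (g := 0.3914) (s := 2.2649) (by norm_num) (by norm_num) (by norm_num) (by norm_num) (by norm_num)
    have hR' : (0.3914 : ℝ) - 1 / (2 * (3 * (171 / 100)) ^ 2) + 26.5875 / (32 * ((3 * (171 / 100)) ^ 3 * 2.2649)) ≤ 0.3753 := by
      norm_num
    have hQ := (term2_le_of_ge_cubic_us (by norm_num) hprev.le hc hV).2.2
    linarith
  have hprev := hc
  rcases le_or_gt y (181 / 100) with hc | hc
  · -- cell [1.76, 1.81]: P ≤ 0.6103, left(T) ≤ 0.3459, R ≤ 0.3705, total 9.9235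
    have hP := term1_le_of_gep_us (by norm_num) hprev.le
    have hE := k13_expA_44_25
    have hP' : Real.exp (3 * (44 / 25) ^ 2 * (34 / 25) - 2 * (44 / 25) ^ 3) / (3 * (44 / 25) ^ 2) ≤ 0.6103 := by
      rw [div_le_iff₀ (by norm_num)]; linarith
    have hR := rcubic_le (m := 3 * (44 / 25)) (g := 0.3858) (s := 2.2978) (by norm_num) (by norm_num) (by norm_num) (by norm_num) (by norm_num)
    have hR' : (0.3858 : ℝ) - 1 / (2 * (3 * (44 / 25)) ^ 2) + 26.5875 / (32 * ((3 * (44 / 25)) ^ 3 * 2.2978)) ≤ 0.3705 := by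
      norm_num
    have hQ := (term2_le_of_ge_cubic_us (by norm_num) hprev.le hc hV).2.2
    linarith
  have hprev := hc
  rcases le_or_gt y (93 / 50) with hc | hc
  · -- cell [1.81, 1.86]: P ≤ 0.4597, left(T) ≤ 0.3702, R ≤ 0.3659, total 10.0290
    have hP := term1_le_of_gep_us (by norm_num) hprev.le
    have hE := k13_expA_181_100
    have hP' : Real.exp (3 * (181 / 100) ^ 2 * (34 / 25) - 2 * (181 / 100) ^ 3) / (3 * (181 / 100) ^ 2) ≤ 0.4597 := by
      rw [div_le_iff₀ (by norm_num)]; linarith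
    have hR := rcubic_le (m := 3 * (181 / 100)) (g := 0.3805) (s := 2.3302) (by norm_num) (by norm_num) (by norm_num) (by norm_num) (by norm_num)
    have hR' : (0.3805 : ℝ) - 1 / (2 * (3 * (181 / 100)) ^ 2) + 26.5875 / (32 * ((3 * (181 / 100)) ^ 3 * 2.3302)) ≤ 0.3659 := by
      norm_num
    have hQ := (term2_le_of_ge_cubic_us (by norm_num) hprev.le hc hV).2.2
    linarith
  have hprev := hc
  have hc := hhi
  -- cell [1.86, 1.885]: P ≤ 0.3353, left(T) ≤ 0.3830, R ≤ 0.3614, total 10.0125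
  have hP := term1_le_of_gep_us (by norm_num) hprev.le
  have hE := k13_expA_93_50
  have hP' : Real.exp (3 * (93 / 50) ^ 2 * (34 / 25) - 2 * (93 / 50) ^ 3) / (3 * (93 / 50) ^ 2) ≤ 0.3353 := by
    rw [div_le_iff₀ (by norm_num)]; linarith
  have hR := rcubic_le (m := 3 * (93 / 50)) (g := 0.3753) (s := 2.3622) (by norm_num) (by norm_num) (by norm_num) (by norm_num) (by norm_num)
  have hR' : (0.3753 : ℝ) - 1 / (2 * (3 * (93 / 50)) ^ 2) + 26.5875 / (32 * ((3 * (93 / 50)) ^ 3 * 2.3622)) ≤ 0.3614 := by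
    norm_num
  have hQ := (term2_le_of_ge_cubic_us (by norm_num) hprev.le hc hV).2.2
  linarith

/-- The `κ₁₃`-bound on the range no. 2 of `y ≥ 34/25`. [folklore] -/
theorem kappa13_le_part2 {y V : ℝ} (hlo : 377 / 200 ≤ y) (hV : 34 / 25 ≤ V) :
    Real.exp (-2 * y ^ 3) * (∫ u in (0 : ℝ)..34 / 25, Real.exp (3 * y ^ 2 * u))
      + 13 * ∫ u in (34 / 25 : ℝ)..V, Real.exp (-((u - y) ^ 2 * (u + 2 * y))) ≤ 10.1 := by
  rcases le_or_gt y (477 / 200) with hc | hc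
  · -- cell [1.885, 2.385]: P ≤ 0.2827, left(G) ≤ 0.3914, R ≤ 0.3592, total 10.0405
    have hP := term1_le_of_gep_us (by norm_num) hlo
    have hE := k13_expA_377_200
    have hP' : Real.exp (3 * (377 / 200) ^ 2 * (34 / 25) - 2 * (377 / 200) ^ 3) / (3 * (377 / 200) ^ 2) ≤ 0.2827 := by
      rw [div_le_iff₀ (by norm_num)]; linarith
    have hR := rcubic_le (m := 3 * (377 / 200)) (g := 0.3728) (s := 2.3780) (by norm_num) (by norm_num) (by norm_num) (by norm_num) (by norm_num)
    have hR' : (0.3728 : ℝ) - 1 / (2 * (3 * (377 / 200)) ^ 2) + 26.5875 / (32 * ((3 * (377 / 200)) ^ 3 * 2.3780)) ≤ 0.3592 := by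
      norm_num
    have hG1 : Real.sqrt (π / (34 / 25 + 2 * (377 / 200))) / 2 ≤ 0.3914 :=
      sqrt_pi_div_le (by norm_num) (by norm_num) (by norm_num)
    have hQ := (term2_le_of_ge_cubic_us (by norm_num) hlo hc hV).2.1
    linarith
  have hprev := hc
  rcases le_or_gt y (577 / 200) with hc | hc
  · -- cell [2.385, 2.885]: P ≤ 0.0048, left(G) ≤ 0.3581, R ≤ 0.3227, total 8.8552
    have hP := term1_le_of_gep_us (by norm_num) hprev.le
    have hE : Real.exp (3 * (477 / 200) ^ 2 * (34 / 25) - 2 * (477 / 200) ^ 3) ≤ 0.0793 := by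
      have := exp_neg_le_of_quadratic (c := 15699501 / 4000000) (X := 0.0793) (by norm_num) (by norm_num) (by norm_num)
      convert this using 2; norm_num
    have hP' : Real.exp (3 * (477 / 200) ^ 2 * (34 / 25) - 2 * (477 / 200) ^ 3) / (3 * (477 / 200) ^ 2) ≤ 0.0048 := by
      rw [div_le_iff₀ (by norm_num)]; linarith
    have hR := rcubic_le (m := 3 * (477 / 200)) (g := 0.3315) (s := 2.6748) (by norm_num) (by norm_num) (by norm_num) (by norm_num) (by norm_num)
    have hR' : (0.3315 : ℝ) - 1 / (2 * (3 * (477 / 200)) ^ 2) + 26.5875 / (32 * ((3 * (477 / 200)) ^ 3 * 2.6748)) ≤ 0.3227 := by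
      norm_num
    have hG1 : Real.sqrt (π / (34 / 25 + 2 * (477 / 200))) / 2 ≤ 0.3581 :=
      sqrt_pi_div_le (by norm_num) (by norm_num) (by norm_num)
    have hQ := (term2_le_of_ge_cubic_us (by norm_num) hprev.le hc hV).2.1
    linarith
  have hprev := hc
  rcases le_or_gt y (677 / 200) with hc | hc
  · -- cell [2.885, 3.385]: P ≤ 0.0005, left(G) ≤ 0.3320, R ≤ 0.2953, total 8.1554
    have hP := term1_le_of_gep_us (by norm_num) hprev.le
    have hE : Real.exp (3 * (577 / 200) ^ 2 * (34 / 25) - 2 * (577 / 200) ^ 3) ≤ 0.0089 := by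
      have := exp_neg_le_of_quadratic (c := 56265001 / 4000000) (X := 0.0089) (by norm_num) (by norm_num) (by norm_num)
      convert this using 2; norm_num
    have hP' : Real.exp (3 * (577 / 200) ^ 2 * (34 / 25) - 2 * (577 / 200) ^ 3) / (3 * (577 / 200) ^ 2) ≤ 0.0005 := by
      rw [div_le_iff₀ (by norm_num)]; linarith
    have hR := rcubic_le (m := 3 * (577 / 200)) (g := 0.3014) (s := 2.9419) (by norm_num) (by norm_num) (by norm_num) (by norm_num) (by norm_num)
    have hR' : (0.3014 : ℝ) - 1 / (2 * (3 * (577 / 200)) ^ 2) + 26.5875 / (32 * ((3 * (577 / 200)) ^ 3 * 2.9419)) ≤ 0.2953 := by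
      norm_num
    have hG1 : Real.sqrt (π / (34 / 25 + 2 * (577 / 200))) / 2 ≤ 0.3320 :=
      sqrt_pi_div_le (by norm_num) (by norm_num) (by norm_num)
    have hQ := (term2_le_of_ge_cubic_us (by norm_num) hprev.le hc hV).2.1
    linarith
  have hprev := hc
  -- cell [3.385, ∞): P ≤ 0.0002, left(G) ≤ 0.3110, R ≤ 0.2739, total 7.6039
  have hP := term1_le_of_gep_us (by norm_num) hprev.le
  have hE : Real.exp (3 * (677 / 200) ^ 2 * (34 / 25) - 2 * (677 / 200) ^ 3) ≤ 0.0021 := by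
    have := exp_neg_le_of_quadratic (c := 123290501 / 4000000) (X := 0.0021) (by norm_num) (by norm_num) (by norm_num)
    convert this using 2; norm_num
  have hP' : Real.exp (3 * (677 / 200) ^ 2 * (34 / 25) - 2 * (677 / 200) ^ 3) / (3 * (677 / 200) ^ 2) ≤ 0.0002 := by
    rw [div_le_iff₀ (by norm_num)]; linarith
  have hR := rcubic_le (m := 3 * (677 / 200)) (g := 0.2783) (s := 3.1866) (by norm_num) (by norm_num) (by norm_num) (by norm_num) (by norm_num)
  have hR' : (0.2783 : ℝ) - 1 / (2 * (3 * (677 / 200)) ^ 2) + 26.5875 / (32 * ((3 * (677 / 200)) ^ 3 * 3.1866)) ≤ 0.2739 := by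
    norm_num
  have hG1 : Real.sqrt (π / (34 / 25 + 2 * (677 / 200))) / 2 ≤ 0.3110 :=
    sqrt_pi_div_le (by norm_num) (by norm_num) (by norm_num)
  have hQ := (term2_le_of_ge_cubic_us (by norm_num) hprev.le le_rfl hV).2.1
  linarith

/-- **The `κ`-lemma with `C = 13`.** For all `y ≥ 0` and `V ≥ 34/25`,
`e^{−2y³} ∫_0^{34/25} e^{3y²u} du + 13 ∫_{34/25}^{V} e^{−(u−y)²(u+2y)} du ≤ 10.1`
(true supremum `≈ 9.54` near `y = 1.82`; 23 cells in 3 ranges).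
[cite: Ford2002, Lemma 7.3 (proof; with the constant `C` of Theorem 2 replaced by `13`)] -/
theorem kappa13_le {y V : ℝ} (hy : 0 ≤ y) (hV : 34 / 25 ≤ V) :
    Real.exp (-2 * y ^ 3) * (∫ u in (0 : ℝ)..34 / 25, Real.exp (3 * y ^ 2 * u))
      + 13 * ∫ u in (34 / 25 : ℝ)..V, Real.exp (-((u - y) ^ 2 * (u + 2 * y))) ≤ 10.1 := by
  rcases le_or_gt y (34 / 25) with h0 | h0
  · exact kappa13_le_part0 hy h0 hV
  rcases le_or_gt y (377 / 200) with h1 | h1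
  · exact kappa13_le_part1 h0.le h1 hV
  · exact kappa13_le_part2 h1.le hV

/-- The `κ`-lemma with `C = 13` in the form consumed by the main argument: for `y ≥ 0`, `V ≥ 34/25`,
`e^{−2y³} (∫_0^{34/25} e^{3y²u} du + 13 ∫_{34/25}^{V} e^{3y²u − u³} du) ≤ 10.1`.
[cite: Ford2002, Lemma 7.3 (proof)] -/
theorem kappa13_le' {y V : ℝ} (hy : 0 ≤ y) (hV : 34 / 25 ≤ V) :
    Real.exp (-2 * y ^ 3) * ((∫ u in (0 : ℝ)..34 / 25, Real.exp (3 * y ^ 2 * u))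
      + 13 * ∫ u in (34 / 25 : ℝ)..V, Real.exp (3 * y ^ 2 * u - u ^ 3)) ≤ 10.1 := by
  have h := kappa13_le hy hV
  have e1 : Real.exp (-2 * y ^ 3) * (13 * ∫ u in (34 / 25 : ℝ)..V, Real.exp (3 * y ^ 2 * u - u ^ 3))
      = 13 * ∫ u in (34 / 25 : ℝ)..V, Real.exp (-((u - y) ^ 2 * (u + 2 * y))) := by
    rw [mul_left_comm, ← intervalIntegral.integral_const_mul]
    congr 1
    refine integral_congr fun u _ ↦ ?_
    exact exp_neg_two_cube_mul_exp y u
  rw [mul_add, e1]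
  exact h

end FordVK

end Literature.NumberTheory.LFunctions
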